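import Literature.Topology.FourManifolds.TautFoliationsCollarGeneric
import Literature.Topology.FourManifolds.TautFoliationsRingCrossings
import HarnessLib

/-!
# The compact contour leaf of the coned collar contains the contour arcs along the ring

Topic: the coned fence collar, plan (d) F3. Let `E` be the leaf of the contour foliation through
the ring point `p₀ = ringParam c₀ R 0` (a crossing when the mesh is even), at a generic radius.
Along the increasing enumeration `θ₀ = 0 < ⋯ < θ_N = 1` of the crossing parameters
(`RingCrossings`), the ring runs in the closed square `Q_j` on `[θ_j, θ_{j+1}]`; the crossing
points `p_j, p_{j+1}` lie on the boundary of `Q_j`, hence on its contour arc `ringLevel Q_j R`,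
which is connected; the trace of `E` on it is relatively open (local plaques,
`exists_nhds_samePlaque`) and closed (`E` is compact), so **`E` contains every contour arc
`ringLevel Q_j R` and every crossing point** (`ringLevel_subset_leaf_chain`), by induction on `j`.

* `mem_sphere_of_mem_skeleton_of_mem_sq`, `subset_leaf_of_isPreconnected`,
  `ringLevel_subset_leaf_chain` (**proved**).

All statements are [folklore].
-/

noncomputable section

open Set Filter Metric Topology Function Real
open scoped unitInterval
open Literature.Topology.PlanarFoliations

namespace Literature.Topology.FourManifolds

namespace Foliation.ConePosition

open SquareGrid SquareGrid.Grid SquarePolar ConeSquare CollarRadius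

variable {B : Type*} [NormedAddCommGroup B] [NormedSpace ℝ B] {M : Type*} [TopologicalSpace M] {F : Foliation B M}
variable {Γ : C(I, F.GermSpace)} {τ₀ ε : ℝ} {Φ : I → ℝ → M} {c₀ : ℝ × ℝ} {L : ℝ} {hL : 0 < L} {G : ℝ × ℝ → M}
variable (P : ConePosition F G c₀ hL)

omit [NormedSpace ℝ B] in
/-- A skeleton point of a closed square lies on its boundary. [folklore] -/
theorem mem_sphere_of_mem_skeleton_of_mem_sq {q : Fin P.n × Fin P.n} {x : ℝ × ℝ} (hx : x ∈ P.gr.skeleton) (hxq : x ∈ P.gr.sq q) :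
    x ∈ sphere (P.gr.centre q) P.gr.ℓ := by
  obtain ⟨q', hq'⟩ := (P.gr.mem_skeleton_iff).1 hx
  rcases (mem_closedBall.1 hxq).lt_or_eq with hlt | heq
  · -- in the open square of `q`: then `q' = q`, contradiction with the sphere of `q'`
    have hq : q' = q := by
      by_contra hne
      exact disjoint_left.1 (P.gr.ball_disjoint_sq (Ne.symm hne)) (mem_ball.2 hlt) (P.gr.sphere_subset_sq q' hq')
    subst hq
    exact hq'
  · exact mem_sphere.2 heq

variable (hΦ : IsFenceOn F Γ τ₀ ε Φ univ) (hcl : ∀ τ ∈ Ioo (τ₀ - ε) (τ₀ + ε), Φ 1 τ = Φ 0 τ) {τ₁ : ℝ}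
  (hτI : uIcc τ₀ τ₁ ⊆ Ioo (τ₀ - ε) (τ₀ + ε)) (h01 : τ₁ ≠ τ₀)
  (hG : ∀ x, L / 2 ≤ dist x c₀ → G x = Φ (angleParam c₀ x) (levelOfParam τ₀ τ₁ (1 - dist x c₀ / L)))
  (hGc : Continuous G) (hn32 : 32 ≤ P.n)
  (hskelT : ∀ q k, P.gr.edge q k '' Icc 0 (2 * P.gr.ℓ) ⊆ {x | 7 * L / 8 ≤ dist x c₀} →
    ∀ s ∈ Icc 0 (2 * P.gr.ℓ), P.skel (P.gr.edge q k s) = G (P.gr.edge q k s))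
  {R : ℝ} (hR : 15 * L / 16 ≤ R)

include hΦ hcl hτI h01 hG hGc hn32 hskelT hR in
/-- **A preconnected subset of the wiggly ring, in the carrier, meeting a leaf which is closed in
the plane, lies in that leaf.** [folklore] -/
theorem subset_leaf_of_isPreconnected (ho : F.IsTransverselyOriented) {A : Set (ℝ × ℝ)} (hA : IsPreconnected A)
    (hAW : A ⊆ P.wigglyRing R) (hAX : ∀ x ∈ A, x ∈ (P.gr.X₀ : Set (ℝ × ℝ))) {y₀ : P.gr.X₀}
    (hclosed : IsClosed (((↑) : P.gr.X₀ → ℝ × ℝ) '' (P.contourFol ho).leaf y₀))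
    (hmeet : ∃ x ∈ A, ∃ hx : x ∈ (P.gr.X₀ : Set (ℝ × ℝ)), (⟨x, hx⟩ : P.gr.X₀) ∈ (P.contourFol ho).leaf y₀) :
    ∀ x ∈ A, ∀ hx : x ∈ (P.gr.X₀ : Set (ℝ × ℝ)), (⟨x, hx⟩ : P.gr.X₀) ∈ (P.contourFol ho).leaf y₀ := by
  classical
  set E := (P.contourFol ho).leaf y₀ with hE
  set S := ((↑) : P.gr.X₀ → ℝ × ℝ) '' E with hS
  -- membership in `E` of a point of the carrier is membership of its coordinates in `S`
  have hmemS : ∀ (x : ℝ × ℝ) (hx : x ∈ (P.gr.X₀ : Set (ℝ × ℝ))), (⟨x, hx⟩ : P.gr.X₀) ∈ E ↔ x ∈ S := fun x hx ↦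
    ⟨fun h ↦ ⟨_, h, rfl⟩, fun ⟨z, hz, hzx⟩ ↦ by have : z = ⟨x, hx⟩ := Subtype.ext hzx; rw [← this]; exact hz⟩
  -- the open set: union of the local plaque neighbourhoods of the points of `A ∩ S`
  have hloc : ∀ x ∈ A, x ∈ S → ∃ U : Set (ℝ × ℝ), IsOpen U ∧ x ∈ U ∧ ∀ z ∈ U, z ∈ P.wigglyRing R → z ∈ S := by
    intro x hxA hxS
    have hxX := hAX x hxA
    obtain ⟨V, hVo, hvV, hV⟩ := P.exists_nhds_samePlaque hΦ hcl hτI h01 hG hGc hn32 hskelT hR ho ⟨x, hxX⟩ (hAW hxA)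
    refine ⟨((↑) : P.gr.X₀ → ℝ × ℝ) '' V, P.gr.X₀.2.isOpenMap_subtype_val V hVo, ⟨_, hvV, rfl⟩, ?_⟩
    rintro _ ⟨w, hwV, rfl⟩ hwW
    have hsame := hV w hwV hwW
    have hwleaf : w ∈ (P.contourFol ho).leaf (⟨x, hxX⟩ : P.gr.X₀) := by
      rw [contourFol, leaf_biOrient]; exact hsame.mem_leaf
    have hxE : (⟨x, hxX⟩ : P.gr.X₀) ∈ E := (hmemS x hxX).2 hxS
    have hwE : w ∈ E := by
      rw [hE, ← leaf_eq_of_mem hxE]; exact hwleaf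
    exact ⟨w, hwE, rfl⟩
  choose! U hUo hxU hU using hloc
  set u : Set (ℝ × ℝ) := ⋃ x ∈ {x | x ∈ A ∧ x ∈ S}, U x with hu
  have huo : IsOpen u := isOpen_biUnion fun x hx ↦ hUo x hx.1 hx.2
  have hvo : IsOpen Sᶜ := hclosed.isOpen_compl
  -- `A ⊆ u ∪ Sᶜ`
  have hcover : A ⊆ u ∪ Sᶜ := fun x hx ↦ by
    by_cases hxS : x ∈ S
    · exact Or.inl (mem_iUnion₂.2 ⟨x, ⟨hx, hxS⟩, hxU x hx hxS⟩)
    · exact Or.inr hxS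
  -- `A ∩ u` is nonempty
  obtain ⟨x₀, hx₀A, hx₀X, hx₀E⟩ := hmeet
  have hx₀S : x₀ ∈ S := (hmemS x₀ hx₀X).1 hx₀E
  have hAu : (A ∩ u).Nonempty := ⟨x₀, hx₀A, mem_iUnion₂.2 ⟨x₀, ⟨hx₀A, hx₀S⟩, hxU x₀ hx₀A hx₀S⟩⟩
  -- if some point of `A` were outside `S`, preconnectedness would give a point of `A ∩ u ∩ Sᶜ`
  intro x hxA hx
  rw [hmemS x hx]
  by_contra hxS
  have hAv : (A ∩ Sᶜ).Nonempty := ⟨x, hxA, hxS⟩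
  obtain ⟨z, hzA, hzu, hzv⟩ := hA u Sᶜ huo hvo hcover hAu hAv
  obtain ⟨x', hx', hzU⟩ := mem_iUnion₂.1 hzu
  exact hzv (hU x' hx'.1 hx'.2 z hzU (hAW hzA))

include hΦ hcl hτI h01 hG hGc hn32 hskelT hR in
/-- **The leaf through the first crossing point contains all the contour arcs along the ring and
all the crossing points.** Here `θs` is an increasing enumeration of crossing parameters starting
at `0`, `Qs j` closed squares containing the ring arcs between consecutive ones. [folklore] -/
theorem ringLevel_subset_leaf_chain (ho : F.IsTransverselyOriented) (hvert : ∀ v ∈ P.gr.vertices, dist v c₀ ≠ R)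
    (hRL : R + 2 * P.gr.ℓ < L) (hR0 : 0 < R) {N : ℕ} {θs : Fin (N + 1) → ℝ} (hmono : StrictMono θs) (h0 : θs 0 = 0)
    (hskel : ∀ j, ringParam c₀ R (θs j) ∈ P.gr.skeleton) {Qs : Fin N → Fin P.n × Fin P.n}
    (hQs : ∀ j : Fin N, ringParam c₀ R '' Icc (θs (Fin.castSucc j)) (θs j.succ) ⊆ P.gr.sq (Qs j))
    (hy₀X : ringParam c₀ R 0 ∈ (P.gr.X₀ : Set (ℝ × ℝ))) :
    (∀ j : Fin (N + 1), ∃ hx : ringParam c₀ R (θs j) ∈ (P.gr.X₀ : Set (ℝ × ℝ)),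
        (⟨_, hx⟩ : P.gr.X₀) ∈ (P.contourFol ho).leaf (⟨ringParam c₀ R 0, hy₀X⟩ : P.gr.X₀)) ∧
      ∀ j : Fin N, ∀ x ∈ P.ringLevel (Qs j) R, ∀ hx : x ∈ (P.gr.X₀ : Set (ℝ × ℝ)),
        (⟨x, hx⟩ : P.gr.X₀) ∈ (P.contourFol ho).leaf (⟨ringParam c₀ R 0, hy₀X⟩ : P.gr.X₀) := by
  set y₀ : P.gr.X₀ := ⟨ringParam c₀ R 0, hy₀X⟩ with hy₀
  set E := (P.contourFol ho).leaf y₀ with hE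
  -- every point of `W_R` is in the carrier; the crossing points are on `W_R`
  have hWX := P.wigglyRing_subset_X₀ hΦ hcl hτI h01 hG hGc hn32 hskelT hR hvert hRL
  have hpt_ring : ∀ j, dist (ringParam c₀ R (θs j)) c₀ = R := fun j ↦ dist_ringParam hR0.le _
  -- squares `Qs j` meet the ring, the end points of the arcs are on their spheres and on their contour arcs
  have hends : ∀ j : Fin N, ringParam c₀ R (θs (Fin.castSucc j)) ∈ P.ringLevel (Qs j) R ∧ ringParam c₀ R (θs j.succ) ∈ P.ringLevel (Qs j) R := by
    intro j
    have hle : θs (Fin.castSucc j) ≤ θs j.succ := (hmono (Fin.castSucc_lt_succ (i := j))).le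
    have h1 : ringParam c₀ R (θs (Fin.castSucc j)) ∈ P.gr.sq (Qs j) := hQs j ⟨_, ⟨le_rfl, hle⟩, rfl⟩
    have h2 : ringParam c₀ R (θs j.succ) ∈ P.gr.sq (Qs j) := hQs j ⟨_, ⟨hle, le_rfl⟩, rfl⟩
    exact ⟨P.mem_ringLevel_of_mem_sphere hΦ hcl hτI h01 hG hGc hn32 hskelT hR ho
        (P.mem_sphere_of_mem_skeleton_of_mem_sq (hskel _) h1) (hpt_ring _),
      P.mem_ringLevel_of_mem_sphere hΦ hcl hτI h01 hG hGc hn32 hskelT hR ho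
        (P.mem_sphere_of_mem_skeleton_of_mem_sq (hskel _) h2) (hpt_ring _)⟩
  have hQR : ∀ j : Fin N, (P.gr.sq (Qs j) ∩ sphere c₀ R).Nonempty := fun j ↦
    ⟨_, (hends j).1.1, mem_sphere.2 (hpt_ring _)⟩
  -- the leaf is compact, so its image is closed
  have hy₀W : (y₀ : ℝ × ℝ) ∈ P.wigglyRing R := by
    -- `0 = θs 0`, and the first crossing point is on the contour arc of `Qs 0` if `N > 0`; in general it is a ring point of the skeleton
    obtain ⟨q, hq⟩ := (P.gr.mem_skeleton_iff).1 (h0 ▸ hskel 0)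
    exact P.mem_wigglyRing_of_mem_sphere hΦ hcl hτI h01 hG hGc hn32 hskelT hR hq (dist_ringParam hR0.le 0)
  have hEc : IsCompact E := P.isCompact_leaf_of_mem_wigglyRing hΦ hcl hτI h01 hG hGc hn32 hskelT hR ho hvert hRL y₀ hy₀W
  have hclosed : IsClosed (((↑) : P.gr.X₀ → ℝ × ℝ) '' E) := (hEc.image continuous_subtype_val).isClosed
  -- induction along the chain: the crossing point `θs j` is in `E`
  have hchain : ∀ j : ℕ, ∀ hj : j < N + 1, ∃ hx : ringParam c₀ R (θs ⟨j, hj⟩) ∈ (P.gr.X₀ : Set (ℝ × ℝ)),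
      (⟨_, hx⟩ : P.gr.X₀) ∈ E := by
    intro j
    induction j with
    | zero =>
      intro hj
      have h : ringParam c₀ R (θs ⟨0, hj⟩) = ringParam c₀ R 0 := by rw [show (⟨0, hj⟩ : Fin (N + 1)) = 0 from rfl, h0]
      refine ⟨h ▸ hy₀X, ?_⟩
      have : (⟨ringParam c₀ R (θs ⟨0, hj⟩), h ▸ hy₀X⟩ : P.gr.X₀) = y₀ := Subtype.ext h
      rw [this]
      exact mem_leaf_self _ _
    | succ j ih =>
      intro hj
      have hjN : j < N := by omega
      obtain ⟨hxj, hjE⟩ := ih (by omega)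
      set jj : Fin N := ⟨j, hjN⟩ with hjj
      have hcast : (Fin.castSucc jj) = ⟨j, by omega⟩ := rfl
      have hsucc : jj.succ = ⟨j + 1, hj⟩ := rfl
      -- the arc of `Qs jj` is in `E`
      have harc := P.subset_leaf_of_isPreconnected hΦ hcl hτI h01 hG hGc hn32 hskelT hR ho
        (P.isPreconnected_ringLevel hΦ hcl hτI h01 hG hGc hn32 hskelT hR (hQR jj))
        (fun x hx ↦ mem_iUnion₂.2 ⟨Qs jj, hQR jj, hx⟩) (fun x hx ↦ hWX x (mem_iUnion₂.2 ⟨Qs jj, hQR jj, hx⟩)) hclosed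
        ⟨_, (hends jj).1, hxj, by rw [hcast] at *; exact hjE⟩
      have hx' : ringParam c₀ R (θs ⟨j + 1, hj⟩) ∈ (P.gr.X₀ : Set (ℝ × ℝ)) :=
        hWX _ (mem_iUnion₂.2 ⟨Qs jj, hQR jj, hsucc ▸ (hends jj).2⟩)
      exact ⟨hx', harc _ (hsucc ▸ (hends jj).2) hx'⟩
  refine ⟨fun j ↦ hchain j.1 j.2, fun j x hx hxX ↦ ?_⟩
  obtain ⟨hxj, hjE⟩ := hchain j.1 (by omega)
  exact P.subset_leaf_of_isPreconnected hΦ hcl hτI h01 hG hGc hn32 hskelT hR ho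
    (P.isPreconnected_ringLevel hΦ hcl hτI h01 hG hGc hn32 hskelT hR (hQR j))
    (fun x hx ↦ mem_iUnion₂.2 ⟨Qs j, hQR j, hx⟩) (fun x hx ↦ hWX x (mem_iUnion₂.2 ⟨Qs j, hQR j, hx⟩)) hclosed
    ⟨_, (hends j).1, hxj, hjE⟩ x hx hxX

end Foliation.ConePosition

end Literature.Topology.FourManifolds
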